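import Summits.Langlands.Langlands.Theses.PrimeSwitchSplit
import Summits.Langlands.Langlands.Theorems.IrreducibilityBySelfDualityReciprocityUpToIrreducibilityCorrespondsConj

/-! # Crux attack at birth — stmt-Langlands-18084 `PrimeSwitchSplit.CompatibilityAwayFromLR`
P0 elaboration · P1 S → C re-certification · P2 vacuity-by-design · P5 C → S would build reciprocity data -/

open scoped MatrixGroups NumberField
open IsDedekindDomain Filter
open Literature.NumberTheory.Automorphic Literature.NumberTheory.GaloisRepresentations
open Summit.Langlands Summit.Langlands.Langlands.Theses.PrimeSwitchSplit

namespace CruxAttack18084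

/-- P0: the route decl elaborates. -/
theorem probe : CompatibilityAwayFromLR := by
  sorry

/-- P1 (S → C, independent re-certification of the planner's `compatibilityAwayFromLR_of_langlands`):
the re-typed summit implies the crux; the pinned-geometric hypothesis and the restriction `v ∤ ℓ`
are NOT used (S gives local–global compatibility at every finite place for every irreducible
Satake avatar, by (A) at `Rec` + Chebotarev–Brauer–Nesbitt conjugacy). -/
theorem compatibilityAwayFromLR_of_langlands (h : Langlands) : CompatibilityAwayFromLR := by
  intro K _ _ Rec n hcpt hn π hL ℓ _ ι ρ hirr _hgeo hρ v _hv
  obtain ⟨-, hK⟩ := h K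
  obtain ⟨ρ₀, -, -, hcorr, -⟩ := (hK Rec n hn hcpt).1 π hL ℓ ι
  exact (Summit.Langlands.Langlands.Theorems.ReciprocityUpToIrreducibility.corresponds_of_exists_corresponds
    hirr hρ ⟨ρ₀, hcorr⟩).2 v

/-- P1': S gives the STRONGER form without the geometric hypothesis and at every finite place. -/
theorem strongForm_of_langlands (h : Langlands) :
    ∀ (K : Type) [Field K] [NumberField K] (Rec : ReciprocityData K) (n : ℕ)
      (hcpt : isCompact_glFiniteIntegralLevel n K), 0 < n →
      ∀ (π : CuspidalAutomorphicRepData n K hcpt), π.1.IsLAlgebraic →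
      ∀ (ℓ : ℕ) [Fact ℓ.Prime] (ι : PadicAlgCl ℓ ≃+* ℂ) (ρ : FramedGaloisRep K (PadicAlgCl ℓ) n),
        ρ.toGaloisRep.IsIrreducible →
        (∀ᶠ v : HeightOneSpectrum (𝓞 K) in cofinite, SatakeFrobCompatibleAt ι π.1 ρ v) →
        IsGeometricFramed Rec ρ ∧ ∀ v : HeightOneSpectrum (𝓞 K), LocalGlobalCompatibleAt Rec ι π.1 ρ v := by
  intro K _ _ Rec n hcpt hn π hL ℓ _ ι ρ hirr hρ
  obtain ⟨-, hK⟩ := h K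
  obtain ⟨ρ₀, hirr₀, hgeo₀, hcorr, -⟩ := (hK Rec n hn hcpt).1 π hL ℓ ι
  have hc : IsConjugate ρ₀ ρ :=
    Summit.Langlands.Langlands.Theorems.ReciprocityUpToIrreducibility.isConjugate_of_satakeFrobCompatibleAt
      π.1 ι hirr₀ hcorr.1 hρ
  exact ⟨Summit.Langlands.Langlands.Theorems.ReciprocityUpToIrreducibility.isGeometricFramed_of_isConjugate
      hgeo₀ hc,
    (Summit.Langlands.Langlands.Theorems.ReciprocityUpToIrreducibility.corresponds_of_isConjugate hcorr hc).2⟩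

/-- P2a (vacuity by design): were the interface `ReciprocityData K` empty for every number field, the
crux would hold trivially — its non-vacuity is exactly the shared support item CRD (stmt-Langlands-17930). -/
theorem of_isEmpty_reciprocityData
    (h : ∀ (K : Type) [Field K] [NumberField K], IsEmpty (ReciprocityData K)) :
    CompatibilityAwayFromLR := by
  intro K _ _ Rec
  exact ((h K).false Rec).elim

/-- P2b (vacuity by design): … and likewise if no cuspidal automorphic datum existed in positive rank. -/
theorem of_isEmpty_cuspidal
    (h : ∀ (K : Type) [Field K] [NumberField K] (n : ℕ) (hcpt : isCompact_glFiniteIntegralLevel n K),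
      0 < n → IsEmpty (CuspidalAutomorphicRepData n K hcpt)) :
    CompatibilityAwayFromLR := by
  intro K _ _ Rec n hcpt hn π
  exact ((h K n hcpt hn).false π).elim

/-- P2c: the same emptiness REFUTES the summit (its non-vacuity conjunct at `K = ℚ`). -/
theorem not_langlands_of_isEmpty_reciprocityData
    (h : ∀ (K : Type) [Field K] [NumberField K], IsEmpty (ReciprocityData K)) : ¬ Langlands := by
  intro hL
  obtain ⟨⟨Rec⟩, -⟩ := hL ℚ
  exact (h ℚ).false Rec

/-- P5 (restates-summit probe `C → S`): any proof of `C → Langlands` yields, classically, reciprocity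
data for some number field — i.e. would settle a slice of the tier-0 fact debt CRD; so `C` does not
restate the summit unless CRD is in hand. -/
theorem exists_reciprocityData_of_imp (h : CompatibilityAwayFromLR → Langlands) :
    ∃ (K : Type) (_ : Field K) (_ : NumberField K), Nonempty (ReciprocityData K) := by
  by_contra hne
  push_neg at hne
  have hE : ∀ (K : Type) [Field K] [NumberField K], IsEmpty (ReciprocityData K) :=
    fun K _ _ => ⟨fun Rec => (hne K inferInstance inferInstance).false Rec⟩
  exact not_langlands_of_isEmpty_reciprocityData hE (h (of_isEmpty_reciprocityData hE))

/-- P5': concretely, `C → S` gives the summit's first conjunct for EVERY number field. -/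
theorem canonicalReciprocityData_of_imp (h : CompatibilityAwayFromLR → Langlands)
    (hC : CompatibilityAwayFromLR) : CanonicalReciprocityData :=
  fun F _ _ => (h hC F).1

end CruxAttack18084
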